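import Mathlib
import Summits.Ventures.Crystal3D.Theorems.StickyWulffConstantTextureLiminfTexShadowWallDefs
import Literature.MathematicalPhysics.StatisticalMechanics.BarlowBilayers
import HarnessLib

/-!
# Line `TexShadow` for the crux `TextureLiminf` (stmt-Ventures-19483) — ZIGZAG-FLUX VOCABULARY file
# (the walker-covered / zigzag-deficit split of the wall stub, in T currency; cf-p1 ROUTE.md §86(26) U, §86(32) AA, §86(42) AK)

HONEST FRAMING. Part of the venture `Summits/Ventures/Crystal3D` (cell `crystal3d-full`), route
`route-Ventures-StickyWulffConstant`, crux `TextureLiminf` (stmt-Ventures-19483), registered line `TexShadow` (v6.6).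
Definitions only; nothing is proved or claimed about the stubs.  Rung credit only; F-C1 not moved.

Lane G's walker ledger with PER-TOP frames on a clamped BARLOW plate (19480-p2 CAP-START, `…GenericWallFloorCapStart`,
memo `HOME/wall-p2-g7/WALKER-COVERAGE-g7.md`) launches ONE family of stack walkers per plate: from a top over a `Δ`-bilayer
(`σ i = 1`, frame `L`) the 1-level start stepping by the best UPPER bond `L v` of that bilayer, from a top over a
`∇`-bilayer (`σ i = −1`, twin frame `L ∘ M`, `M` the basal mirror) the 2-level start stepping by the best-rising capper
`bestCapper (L∘M) (L e₃) z` — in both cases the e-steepest of the three inter-layer bonds of THAT bilayer pointing from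
its e-lower to its e-upper layer (`e = e₃` for the bottom plate, `−e₃` for the top plate; vertical `z = e`).  The family
exists iff the steeper class is steep (`rise ≥ τ`, `τ = √2/2` for `walkInv_capStart₂`'s `hsteep`; `9/20` with wide-tilt
verticals), and then the number of starts per unit area of a horizontal cut inside the strip of bilayer `i` is
`√2 · rise(i)` (one line per ball per layer; memo §3: `κ = √2·⟨e₃-rise per step⟩`, chord-weighted over the layers the disc
sees = strip by strip).  This file names these quantities so that v6.7 can split `stub_bilayerWallGeneric` into the
WALKER-COVERED tables and the ZIGZAG residual:

* `upSlot₁ upSlot₂ upSlot₃` — the three upper bond vectors of the reference bilayer (`barlowPos … constHagg 1 i j`,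
  `(i,j) ∈ {(0,0), (−1,0), (0,−1)}`: heights `√(2/3)`);
* `bilayerRise L σ e i` — the e-rise of the zigzag step of bilayer `i` (coordinate formula: with `ν = L⁻¹ e` and
  `sgn = sign ν₂`, the max over the three upper slots `w` of `sgn·⟪w, ν⟫` if `σ i = 1`, of `−sgn·⟪w, M ν⟫` if not);
* `PlateLaunchable τ L σ e` — some bilayer of the stacking has rise `≥ τ` (the family's bottom entry exists);
* `plateFlux τ L σ e i := √2 · bilayerRise L σ e i` if launchable, `0` otherwise — the per-strip flux of starts;
* `FluxDominated τ L₁ σ₁ L₂ σ₂ c := ∀ i j, c i j ≤ ½ (plateFlux τ L₁ σ₁ e₃ i + plateFlux τ L₂ σ₂ (−e₃) j)` — the charge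
  table is dominated by what the two plates' walker families deliver strip by strip (the WALKER-COVERED tables); its
  negation on an admissible table is the ZIGZAG DEFICIT of the pair (cf-p1 §86(32) AA: `{κ₁ + κ₂ < 2}`, 22.8 % of Haar
  for hcp|hcp, floor `0.612`).
The T-side chain for the covered part is then: CAP-START families (19480-p2) ↦ flux count
`#T₁ + #T₂ ≥ Σ_i plateFlux₁ i·|slice ∩ laySlab₁ i| + Σ_j plateFlux₂ j·|slice ∩ laySlab₂ j| − C(1+h)ρ` (open) ↦
`charge_le_flux` (`…TextureLiminfChargeFlux`) ↦ `walkerFamilies_card_le_payers` ↦ `bilayerWallAt_of_payerBound`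
(`…TextureLiminfBilayerWallBookkeeping`).
WHAT THIS IS NOT: any statement about the stubs; no claim that the zigzag deficit is or is not paid; F-C1 not moved.
-/

open scoped BigOperators InnerProductSpace ENNReal
open MeasureTheory Filter

namespace Summit.Ventures.Crystal3D.Cruxes.TextureLiminf.TexShadow

open Summit.Ventures.Crystal3D
open Literature.MathematicalPhysics.StatisticalMechanics (barlowPos constHagg basalMirror)

/-! ## The three upper slots of the reference bilayer -/

/-- the upper bond `barlowPos 1 √(2/3) constHagg 1 0 0 = (½, √3/6, √(2/3))` of the reference frame. -/
noncomputable def upSlot₁ : E3 := barlowPos 1 (Real.sqrt (2 / 3)) constHagg 1 0 0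

/-- the upper bond `barlowPos 1 √(2/3) constHagg 1 (−1) 0 = (−½, √3/6, √(2/3))`. -/
noncomputable def upSlot₂ : E3 := barlowPos 1 (Real.sqrt (2 / 3)) constHagg 1 (-1) 0

/-- the upper bond `barlowPos 1 √(2/3) constHagg 1 0 (−1) = (0, −√3/3, √(2/3))`. -/
noncomputable def upSlot₃ : E3 := barlowPos 1 (Real.sqrt (2 / 3)) constHagg 1 0 (-1)

/-! ## The zigzag rise and flux of a bilayer, the launchable plates, the flux-dominated tables -/

/-- e-component of the inter-layer bond of bilayer `i` (word `σ`, frame `L`) with reference upper slot `w`, ORIENTED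
from the e-lower to the e-upper layer: in model coordinates `ν = L⁻¹ e` the bond from layer `i` to layer `i+1` is `L w`
(`σ i = 1`) resp. `−L (M w)` (else), and it points e-upward iff `ν₂ ≥ 0`. -/
noncomputable def bondRise (L : E3 ≃ₗᵢ[ℝ] E3) (σ : ℤ → ℤ) (e : E3) (i : ℤ) (w : E3) : ℝ :=
  (if 0 ≤ (L.symm e) 2 then (1 : ℝ) else -1) *
    (if σ i = 1 then ⟪w, L.symm e⟫_ℝ else -⟪w, basalMirror (L.symm e)⟫_ℝ)

/-- **the zigzag RISE of bilayer `i` toward `e`**: the best e-component of its three e-upward inter-layer bonds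
(`= ⟪L v, e⟫` for the class-best upper bond `v` of a `Δ`-bilayer, `= ⟪(L∘M) q, e⟫` for the best-rising capper `q` of a
`∇`-bilayer when the walk's vertical is `e`). -/
noncomputable def bilayerRise (L : E3 ≃ₗᵢ[ℝ] E3) (σ : ℤ → ℤ) (e : E3) (i : ℤ) : ℝ :=
  max (max (bondRise L σ e i upSlot₁) (bondRise L σ e i upSlot₂)) (bondRise L σ e i upSlot₃)

/-- **the plate is LAUNCHABLE toward `e` at steepness `τ`**: some bilayer of the stacking `(L, σ)` has zigzag rise `≥ τ`
(its class serves as the common bottom entry `⟨F₀, v₀, 0⟩` of the plate's walker family; `τ = √2/2` is `hsteep` of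
`walkInv_capStart` / `walkInv_capStart₂` with vertical `z = e`). -/
def PlateLaunchable (τ : ℝ) (L : E3 ≃ₗᵢ[ℝ] E3) (σ : ℤ → ℤ) (e : E3) : Prop :=
  ∃ i : ℤ, τ ≤ bilayerRise L σ e i

open scoped Classical in
/-- **the per-strip FLUX of walker starts of the plate** `(L, σ)` toward `e`: `√2 · bilayerRise` on every bilayer if the
plate is launchable at steepness `τ`, `0` otherwise (number of starts per unit area of a horizontal cut inside the strip of
bilayer `i`, up to the rim). -/
noncomputable def plateFlux (τ : ℝ) (L : E3 ≃ₗᵢ[ℝ] E3) (σ : ℤ → ℤ) (e : E3) (i : ℤ) : ℝ :=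
  if PlateLaunchable τ L σ e then Real.sqrt 2 * bilayerRise L σ e i else 0

/-- **the charge table `c` is FLUX-DOMINATED** (walker-covered) for the bottom plate `(L₁, σ₁)` (walkers toward `e₃`) and
the top plate `(L₂, σ₂)` (walkers toward `−e₃`): strip by strip, `c i j ≤ ½ (plateFlux₁ i + plateFlux₂ j)`.  The tables
admissible for P's law but NOT flux-dominated form the zigzag deficit of the pair. -/
def FluxDominated (τ : ℝ) (L₁ : E3 ≃ₗᵢ[ℝ] E3) (σ₁ : ℤ → ℤ) (L₂ : E3 ≃ₗᵢ[ℝ] E3) (σ₂ : ℤ → ℤ)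
    (c : ℤ → ℤ → ℝ) : Prop :=
  ∀ i j : ℤ, c i j ≤ (plateFlux τ L₁ σ₁ e₃ i + plateFlux τ L₂ σ₂ (-e₃) j) / 2

end Summit.Ventures.Crystal3D.Cruxes.TextureLiminf.TexShadow
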